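import Summits.HodgeConjecture.HodgeConjecture.Theses.HeckePrymWeil
import Summits.HodgeConjecture.HodgeConjecture.Theorems.HeckePrymWeilWeilVariationalHodgeBaseReduction
import Summits.HodgeConjecture.HodgeConjecture.Theorems.AnchorTransportVariationalHodgeReductions

/-!
# Route HeckePrymWeil — `WeilVariationalHodge` (stmt-HodgeConjecture-14497), line `Sketch` (v2):
# reduction to affine bases (`stub_affineReduction`)

The rung `(p, M)` of the crux `HeckePrymWeil.WeilVariationalHodge` quantifies over smooth projective
families `f : 𝒳 ⟶ S` of relative dimension `2M`, all of whose complex fibres are abelian `2M`-folds with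
`√-p`-multiplication, over a smooth IRREDUCIBLE `ℂ`-scheme `S` that is not assumed affine, separated or
quasi-compact. This file proves that the rung over smooth irreducible AFFINE bases implies the rung over
all smooth irreducible bases.

Proof. The property `P t := (W|_{𝒳_t} ∈ A^M(𝒳_t))` of complex points `t ∈ S(ℂ)` propagates along affine
opens of the irreducible Jacobson base (`forall_complexPoints_of_affineOpens`: affine opens `U₀ ∋ pt s₀`,
`U ∋ pt s` meet in an open containing a closed point, which underlies a complex point `u`; go
`s₀ → u → s`), once it passes from `a` to `b` whenever `pt a`, `pt b` lie in a common affine open `U`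
(`weilRung_step_of_affine`, the `variationalHodge_step_of_affine` of stmt-1076 with the Weil-fibre
hypothesis added): restrict the family to `U` (`Motives.openSubschemeOver`: affine, irreducible as a
nonempty open of an irreducible space, smooth over `ℂ`; `Motives.familyPullback` along
`openSubschemeOverι`), lift `a`, `b` to `U` (`AlgPoints.range_map_of_isOpenImmersion_holds`), move the
fibrewise hypotheses (`familyPullback_fibrewise_rational_hodge`), the Weil-fibre isomorphisms
(`familyPullback_fibrewise_weil`) and the anchor (`familyPullback_mem_algebraicClasses_iff`) to the base
change, apply the affine rung, and move the conclusion back.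
-/

noncomputable section

-- every declaration of this problem lives in `Summit.HodgeConjecture.HodgeConjecture.…` (summit = sub-problem)
set_option linter.dupNamespace false

open CategoryTheory AlgebraicGeometry TopologicalSpace MonoidalCategory
open Literature.AlgebraicGeometry.Motives Literature.AlgebraicGeometry.HodgeTheory

namespace Summit.HodgeConjecture.HodgeConjecture.Theorems

/-- **One step inside an affine open** (the `variationalHodge_step_of_affine` of stmt-1076 for the Weil
rung). If the rung `(p, M)` of `WeilVariationalHodge` holds over smooth irreducible AFFINE bases, then for
a family of the rung over a smooth irreducible `S` algebraicity of `W|_{𝒳_a}` passes to `W|_{𝒳_b}`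
whenever `pt a`, `pt b` lie in a common affine open `U ⊆ S`: restrict the family to `U`
(`Motives.openSubschemeOver`, affine, irreducible as a nonempty open of an irreducible space, smooth over
`ℂ`), lift `a`, `b` to `U` (`AlgPoints.range_map_of_isOpenImmersion_holds`), move the fibrewise
hypotheses (`familyPullback_fibrewise_rational_hodge`), the Weil-fibre isomorphisms
(`familyPullback_fibrewise_weil`) and the anchor to the base change, apply the affine rung, and move the
conclusion back (`familyPullback_mem_algebraicClasses_iff`). [folklore] -/
theorem weilRung_step_of_affine {p M : ℕ}
    (h : ∀ ⦃𝒳 S : SchemeOver ℂ⦄ (f : 𝒳 ⟶ S), IsSmoothProjectiveFamily f (2 * M) →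
      IrreducibleSpace S.left → IsAffine S.left → AlgebraicGeometry.Smooth S.hom →
      ∀ (W : complexBetti 𝒳 (2 * M)),
      (∀ s : ComplexPoints S, IsRationalClass (complexBetti.map (fiberι f s) (2 * M) W) ∧
        IsOfHodgeType (2 * M) (fiberOver f s) (2 * M) M M (complexBetti.map (fiberι f s) (2 * M) W)) →
      (∀ s : ComplexPoints S, ∃ (A' : AbelianVariety ℂ) (φ' : A' ⟶ A'), A'.dim = (2 * M) ∧
        φ' ≫ φ' = -((p : ℤ) • 𝟙 A') ∧ Nonempty (A'.X ≅ fiberOver f s)) →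
      (∃ s₀ : ComplexPoints S,
        complexBetti.map (fiberι f s₀) (2 * M) W ∈ algebraicClasses (fiberOver f s₀) M) →
      ∀ s : ComplexPoints S,
        complexBetti.map (fiberι f s) (2 * M) W ∈ algebraicClasses (fiberOver f s) M)
    {𝒳 S : SchemeOver ℂ} (f : 𝒳 ⟶ S) (hf : IsSmoothProjectiveFamily f (2 * M))
    [IrreducibleSpace S.left] [AlgebraicGeometry.Smooth S.hom] (W : complexBetti 𝒳 (2 * M))
    (hW : ∀ s : ComplexPoints S, IsRationalClass (complexBetti.map (fiberι f s) (2 * M) W) ∧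
      IsOfHodgeType (2 * M) (fiberOver f s) (2 * M) M M (complexBetti.map (fiberι f s) (2 * M) W))
    (hA : ∀ s : ComplexPoints S, ∃ (A' : AbelianVariety ℂ) (φ' : A' ⟶ A'), A'.dim = (2 * M) ∧
      φ' ≫ φ' = -((p : ℤ) • 𝟙 A') ∧ Nonempty (A'.X ≅ fiberOver f s))
    (U : S.left.Opens) (hU : IsAffineOpen U) (a b : ComplexPoints S) (haU : a.pt ∈ U) (hbU : b.pt ∈ U)
    (ha : complexBetti.map (fiberι f a) (2 * M) W ∈ algebraicClasses (fiberOver f a) M) :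
    complexBetti.map (fiberι f b) (2 * M) W ∈ algebraicClasses (fiberOver f b) M := by
  -- the affine open `U` as a smooth irreducible affine `ℂ`-scheme `g : U ⟶ S`
  haveI : IsOpenImmersion (openSubschemeOverι S U).left := inferInstanceAs (IsOpenImmersion U.ι)
  have hUaff : IsAffine (openSubschemeOver S U).left := hU
  have hUirr : IrreducibleSpace (openSubschemeOver S U).left := by
    change IrreducibleSpace U
    exact isIrreducible_iff_irreducibleSpace.mp ⟨⟨a.pt, haU⟩,
      (PreirreducibleSpace.isPreirreducible_univ (X := S.left)).open_subset U.isOpen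
        (Set.subset_univ _)⟩
  have hUsm : AlgebraicGeometry.Smooth (openSubschemeOver S U).hom := by
    change AlgebraicGeometry.Smooth (U.ι ≫ S.hom)
    infer_instance
  -- lift `a`, `b` to `U`
  have hrange : Set.range (AlgPoints.map (L := ℂ) (openSubschemeOverι S U)) = {P | P.pt ∈ U} := by
    rw [AlgPoints.range_map_of_isOpenImmersion_holds]
    ext P
    change P.pt ∈ U.ι.opensRange ↔ P.pt ∈ U
    rw [Scheme.Opens.opensRange_ι]
  obtain ⟨a', rfl⟩ : a ∈ Set.range (AlgPoints.map (L := ℂ) (openSubschemeOverι S U)) := by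
    rw [hrange]; exact haU
  obtain ⟨b', rfl⟩ : b ∈ Set.range (AlgPoints.map (L := ℂ) (openSubschemeOverι S U)) := by
    rw [hrange]; exact hbU
  -- base change to `U`, apply the affine rung, and come back
  rw [← familyPullback_mem_algebraicClasses_iff (openSubschemeOverι S U) hf M W b']
  exact h (familyPullback.snd f (openSubschemeOverι S U)) (hf.familyPullback_snd _) hUirr hUaff hUsm
    (complexBetti.map (familyPullback.fst f (openSubschemeOverι S U)) (2 * M) W)
    (familyPullback_fibrewise_rational_hodge f (openSubschemeOverι S U) W hW)
    (familyPullback_fibrewise_weil f (openSubschemeOverι S U) hA)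
    ⟨a', (familyPullback_mem_algebraicClasses_iff (openSubschemeOverι S U) hf M W a').2 ha⟩ b'

/-- **Stub (affine reduction).** The rung `(p, M)` of `WeilVariationalHodge` over smooth irreducible AFFINE
bases implies the rung over all smooth irreducible bases: affine opens `U₀ ∋ pt s₀`, `U ∋ pt s` of the
irreducible base meet in an open containing a closed point, which underlies a complex point `u` (Jacobson);
restrict the family to `U₀` and to `U` (`Motives.familyPullback` along `openSubschemeOverι`), move the
fibrewise hypotheses, the Weil-fibre isomorphisms (`familyPullback_fibrewise_weil`) and the anchor across
`fiberOverFamilyPullbackIso`, and go `s₀ → u → s` (`forall_complexPoints_of_affineOpens`,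
`weilRung_step_of_affine`). [folklore] -/
theorem stub_affineReduction (p M : ℕ) :
    (∀ ⦃𝒳 S : SchemeOver ℂ⦄ (f : 𝒳 ⟶ S), IsSmoothProjectiveFamily f (2 * M) → IrreducibleSpace S.left →
      IsAffine S.left → AlgebraicGeometry.Smooth S.hom → ∀ (W : complexBetti 𝒳 (2 * M)),
      (∀ s : ComplexPoints S, IsRationalClass (complexBetti.map (fiberι f s) (2 * M) W) ∧
        IsOfHodgeType (2 * M) (fiberOver f s) (2 * M) M M (complexBetti.map (fiberι f s) (2 * M) W)) →
      (∀ s : ComplexPoints S, ∃ (A' : AbelianVariety ℂ) (φ' : A' ⟶ A'), A'.dim = (2 * M) ∧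
        φ' ≫ φ' = -((p : ℤ) • 𝟙 A') ∧ Nonempty (A'.X ≅ fiberOver f s)) →
      (∃ s₀ : ComplexPoints S, complexBetti.map (fiberι f s₀) (2 * M) W ∈ algebraicClasses (fiberOver f s₀) M) →
      ∀ s : ComplexPoints S, complexBetti.map (fiberι f s) (2 * M) W ∈ algebraicClasses (fiberOver f s) M) →
    ∀ ⦃𝒳 S : SchemeOver ℂ⦄ (f : 𝒳 ⟶ S), IsSmoothProjectiveFamily f (2 * M) → IrreducibleSpace S.left →
      AlgebraicGeometry.Smooth S.hom → ∀ (W : complexBetti 𝒳 (2 * M)),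
      (∀ s : ComplexPoints S, IsRationalClass (complexBetti.map (fiberι f s) (2 * M) W) ∧
        IsOfHodgeType (2 * M) (fiberOver f s) (2 * M) M M (complexBetti.map (fiberι f s) (2 * M) W)) →
      (∀ s : ComplexPoints S, ∃ (A' : AbelianVariety ℂ) (φ' : A' ⟶ A'), A'.dim = (2 * M) ∧
        φ' ≫ φ' = -((p : ℤ) • 𝟙 A') ∧ Nonempty (A'.X ≅ fiberOver f s)) →
      (∃ s₀ : ComplexPoints S, complexBetti.map (fiberι f s₀) (2 * M) W ∈ algebraicClasses (fiberOver f s₀) M) →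
      ∀ s : ComplexPoints S, complexBetti.map (fiberι f s) (2 * M) W ∈ algebraicClasses (fiberOver f s) M := by
  intro h 𝒳 S f hf hirr hsm W hW hA hs₀ s
  obtain ⟨s₀, hs₀⟩ := hs₀
  haveI := hirr
  haveI := hsm
  exact forall_complexPoints_of_affineOpens
    (fun t => complexBetti.map (fiberι f t) (2 * M) W ∈ algebraicClasses (fiberOver f t) M)
    (fun U hU a b haU hbU ha => weilRung_step_of_affine h f hf W hW hA U hU a b haU hbU ha) hs₀ s

end Summit.HodgeConjecture.HodgeConjecture.Theorems

end
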